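import Summits.Ventures.PercRepro.ProfilePointedCircuitClassesStarSharpD0L1

/-!
# PercRepro — CASE D0 OF `StarNineSharp`, PART M: THE OPPOSITE-VERTEX LEMMAS L1 AND L3
(p5, gen 54; `proofs/P5-GM1.md` §81 ADD 1)

`rk_insert_e_union_eq_four`: when `π ∪ W` has rank `3` (`W = X − π − t`, `t` in the demand plane), adding `e` gives
rank `4` (else the plane would hold `X + e`).  L1 `opp_in_coff_of_on_line` (`W` an ON line) and L3
`third_in_coff` (`{x} ∪ W = X − π₂` the ON complement of a second demand `π₂ = {y, z}` of the same plane) both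
feed D0L's `opp_in_coff_of_key`: in each case `ρ(π ∪ W) ≤ 3` would make `π ∪ W` an ON set of rank `3` meeting the
demand plane in the line `π`, so `π` would be an ON line and the swap `π + f` an ON target, against R0 failing.
-/

open scoped Matroid

namespace PercRepro.Cogirth

open Finset ThmH Skew Shadow Profile

variable {α : Type} [DecidableEq α] {N : Matroid α} [N.Finite]

section StarSharpD0M

variable {b b' : α}

/-- When `π ∪ W` has rank `3`, `e` adds rank: else `t ∈ cl(π + e)` puts `X + e` in a plane. -/
theorem rk_insert_e_union_eq_four (hn : (gr N).card = 9) {e f : α}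
    (he : e ∈ gr N) (hf : f ∈ gr N) (hef : e ≠ f) (heb : e ≠ b) (heb' : e ≠ b') (hfb : f ≠ b) (hfb' : f ≠ b')
    (hX : rk N (((((gr N).erase b).erase b').erase f).erase e) = 4)
    {π : Finset α} (hπ : π ⊆ ((((gr N).erase b).erase b').erase f).erase e) (hY : rk N (insert e π) = 3)
    {t : α} (htH : rk N (insert t (insert e π)) = 3)
    (hS3 : rk N (π ∪ (((((gr N).erase b).erase b').erase f).erase e \ π).erase t) = 3) :
    rk N (insert e (π ∪ (((((gr N).erase b).erase b').erase f).erase e \ π).erase t)) = 4 := by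
  have _ := hn; have _ := hf; have _ := hfb; have _ := hfb'; have _ := hef
  set X := ((((gr N).erase b).erase b').erase f).erase e with hXdef
  set W := (X \ π).erase t with hWdef
  have hXE : X ⊆ ((gr N).erase b).erase b' := (erase_subset _ _).trans (erase_subset _ _)
  have hXg : X ⊆ gr N := hXE.trans ((erase_subset _ _).trans (erase_subset _ _))
  have hWX : W ⊆ X := (erase_subset _ _).trans sdiff_subset
  by_contra hne'
  have h1 : rk N (insert e (π ∪ W)) ≤ 4 := by
    have := rk_insert_le_add_one (N := N) he (union_subset (hπ.trans hXg) (hWX.trans hXg)); omega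
  have h2 : rk N (π ∪ W) ≤ rk N (insert e (π ∪ W)) := rk_mono' (M := N) (subset_insert _ _)
  have h3 : rk N (insert e (π ∪ W)) = 3 := by omega
  have h4 : rk N (insert t (insert e (π ∪ W))) = rk N (insert e (π ∪ W)) := by
    have h5 : rk N (insert t (insert e π)) = rk N (insert e π) := by rw [htH, hY]
    have := rk_insert_union_eq_of_rk_insert_eq' (N := N) (T := insert e (π ∪ W)) h5
    rw [insert_union_insert_union_eq π W e] at this; exact this
  have h6 : rk N X ≤ rk N (insert t (insert e (π ∪ W))) := rk_mono' (M := N) (by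
    intro w hw
    simp only [mem_insert, mem_union]
    by_cases hwt : w = t
    · exact Or.inl hwt
    by_cases hwπ : w ∈ π
    · exact Or.inr (Or.inr (Or.inl hwπ))
    exact Or.inr (Or.inr (Or.inr (mem_erase.2 ⟨hwt, mem_sdiff.2 ⟨hw, hwπ⟩⟩))))
  have _ := heb; have _ := heb'
  omega

/-- **L1**: when `W = X − π − t` is an ON line, the third point `t` of the demand plane is an OFF C-point. -/
theorem opp_in_coff_of_on_line (h : SeriesPair N b b') (hn : (gr N).card = 9) (hR : rk N (gr N) = 5) {e f : α}
    (hnle : ∀ S : Finset α, S ⊆ ((gr N).erase b).erase b' → e ∈ S → rk N (insert b (insert b' S)) ≤ 3 → rk N S ≤ 1)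
    (he : e ∈ gr N) (hf : f ∈ gr N) (hef : e ≠ f) (heb : e ≠ b) (heb' : e ≠ b') (hfb : f ≠ b) (hfb' : f ≠ b')
    (hE7 : rk N (((gr N).erase b).erase b') = 4)
    (he1 : ∀ y ∈ ((((gr N).erase b).erase b').erase f).erase e, rk N {e, y} = 2)
    (hX : rk N (((((gr N).erase b).erase b').erase f).erase e) = 4)
    {π : Finset α} (hπ : π ⊆ ((((gr N).erase b).erase b').erase f).erase e) (hπ2 : π.card = 2)
    (hY : rk N (insert e π) = 3) (hYon : rk N (insert b (insert b' (insert e π))) = 4)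
    (hef4 : rk N (insert f (insert e π)) = 4)
    (hYc : rk N (insert f (((((gr N).erase b).erase b').erase f).erase e \ π)) = 4)
    (hcon : rk N (insert b (insert b' (((((gr N).erase b).erase b').erase f).erase e \ π))) = 4)
    (hR0 : ¬ (rk N (insert f π) = 3 ∧ rk N (insert e (((((gr N).erase b).erase b').erase f).erase e \ π)) = 4 ∧
      rk N (insert b (insert b' (insert f π))) = 4))
    {t : α} (ht : t ∈ ((((gr N).erase b).erase b').erase f).erase e \ π) (htH : rk N (insert t (insert e π)) = 3)
    (hW2 : rk N ((((((gr N).erase b).erase b').erase f).erase e \ π).erase t) = 2)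
    (hWon : rk N (insert b (insert b' ((((((gr N).erase b).erase b').erase f).erase e \ π).erase t))) = 3) :
    rk N {e, f, t} = 3 ∧ rk N ((((((gr N).erase b).erase b').erase f).erase e).erase t) = 4 ∧
      rk N (insert b (insert b' {e, f, t})) = 5 := by
  apply opp_in_coff_of_key h hn hR hnle he hf hef heb heb' hfb hfb' hE7 he1 hX hπ hπ2 hY hYon hef4 hYc hcon hR0 ht htH
    _ hW2
  intro hle
  set X := ((((gr N).erase b).erase b').erase f).erase e with hXdef
  set W := (X \ π).erase t with hWdef
  have hXE : X ⊆ ((gr N).erase b).erase b' := (erase_subset _ _).trans (erase_subset _ _)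
  have hWX : W ⊆ X := (erase_subset _ _).trans sdiff_subset
  have hWE : W ⊆ ((gr N).erase b).erase b' := hWX.trans hXE
  have heX : e ∉ X := fun h' => (mem_erase.1 h').1 rfl
  by_cases hS3 : rk N (π ∪ W) = 3
  · have hSon : rk N (insert b (insert b' (π ∪ W))) = 4 := by
      have := on_of_subset_on_line (N := N) (b := b) (b' := b') (subset_union_right : W ⊆ π ∪ W) hW2 hWon hS3
      have := rk_insert_bb'_bounds h (union_subset (hπ.trans hXE) hWE)
      omega
    have hU : rk N (π ∪ W ∪ insert e π) = 4 := by
      rw [union_insert_eq_insert_union' π W e]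
      exact rk_insert_e_union_eq_four hn he hf hef heb heb' hfb hfb' hX hπ hY htH hS3
    have hI' := rk_inter_bb'_le_three_of_two_on h hR (union_subset (hπ.trans hXE) hWE)
      (insert_subset (mem_erase.2 ⟨heb', mem_erase.2 ⟨heb, he⟩⟩) (hπ.trans hXE)) hSon hYon hU
    rw [union_inter_insert_eq (fun h' => heX (hWX h'))] at hI'; exact hI'
  · have hπr : rk N π = 2 := by
      rw [rk_eq_card_of_subset_of_rk_eq_card (M := N) (subset_insert e π) (by
        rw [hY, card_insert_of_notMem (fun h' => heX (hπ h')), hπ2]), hπ2]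
    have h2 : rk N π ≤ rk N (π ∪ W) := rk_mono' (M := N) subset_union_left
    have hS2 : rk N (π ∪ W) = 2 := by omega
    have hs := rk_union_add_rk_le_of_subset_inter' (N := N) (S := π ∪ W) (T := insert b (insert b' W)) (I := W)
      (by intro w hw; exact mem_inter.2 ⟨mem_union_right _ hw, mem_insert_of_mem (mem_insert_of_mem hw)⟩)
    have h4 : rk N (insert b (insert b' π)) ≤ rk N (π ∪ W ∪ insert b (insert b' W)) :=
      rk_mono' (M := N) (insert_bb'_subset_union b b' π W)
    omega

/-- **L3**: if `π = {x, y}` and `π₂ = {y, t}` are demands of one plane and the complement `X − π₂ = {x} ∪ W` is ON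
of rank `3`, then `t` is an OFF C-point. -/
theorem third_in_coff (h : SeriesPair N b b') (hn : (gr N).card = 9) (hR : rk N (gr N) = 5) {e f : α}
    (hnle : ∀ S : Finset α, S ⊆ ((gr N).erase b).erase b' → e ∈ S → rk N (insert b (insert b' S)) ≤ 3 → rk N S ≤ 1)
    (he : e ∈ gr N) (hf : f ∈ gr N) (hef : e ≠ f) (heb : e ≠ b) (heb' : e ≠ b') (hfb : f ≠ b) (hfb' : f ≠ b')
    (hE7 : rk N (((gr N).erase b).erase b') = 4)
    (he1 : ∀ y ∈ ((((gr N).erase b).erase b').erase f).erase e, rk N {e, y} = 2)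
    (hX : rk N (((((gr N).erase b).erase b').erase f).erase e) = 4)
    {π : Finset α} (hπ : π ⊆ ((((gr N).erase b).erase b').erase f).erase e) (hπ2 : π.card = 2)
    (hY : rk N (insert e π) = 3) (hYon : rk N (insert b (insert b' (insert e π))) = 4)
    (hef4 : rk N (insert f (insert e π)) = 4)
    (hYc : rk N (insert f (((((gr N).erase b).erase b').erase f).erase e \ π)) = 4)
    (hcon : rk N (insert b (insert b' (((((gr N).erase b).erase b').erase f).erase e \ π))) = 4)
    (hR0 : ¬ (rk N (insert f π) = 3 ∧ rk N (insert e (((((gr N).erase b).erase b').erase f).erase e \ π)) = 4 ∧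
      rk N (insert b (insert b' (insert f π))) = 4))
    {t : α} (ht : t ∈ ((((gr N).erase b).erase b').erase f).erase e \ π) (htH : rk N (insert t (insert e π)) = 3)
    {x : α} (hxπ : x ∈ π) (hx3 : rk N (insert x ((((((gr N).erase b).erase b').erase f).erase e \ π).erase t)) = 3)
    (hcon₂ : rk N (insert b (insert b' (insert x ((((((gr N).erase b).erase b').erase f).erase e \ π).erase t)))) = 4) :
    rk N {e, f, t} = 3 ∧ rk N ((((((gr N).erase b).erase b').erase f).erase e).erase t) = 4 ∧
      rk N (insert b (insert b' {e, f, t})) = 5 := by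
  set X := ((((gr N).erase b).erase b').erase f).erase e with hXdef
  set W := (X \ π).erase t with hWdef
  have hXE : X ⊆ ((gr N).erase b).erase b' := (erase_subset _ _).trans (erase_subset _ _)
  have hXg : X ⊆ gr N := hXE.trans ((erase_subset _ _).trans (erase_subset _ _))
  have hWX : W ⊆ X := (erase_subset _ _).trans sdiff_subset
  have hWE : W ⊆ ((gr N).erase b).erase b' := hWX.trans hXE
  have heX : e ∉ X := fun h' => (mem_erase.1 h').1 rfl
  have hE7c : (((gr N).erase b).erase b').card = 7 := by
    rw [card_erase_of_mem (mem_erase.2 ⟨h.2.2.1.symm, h.2.1⟩), card_erase_of_mem h.1, hn]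
  have hXc : X.card = 5 := by
    rw [hXdef, card_erase_of_mem (mem_erase.2 ⟨hef, mem_erase.2 ⟨heb', mem_erase.2 ⟨heb, he⟩⟩⟩),
      card_erase_of_mem (mem_erase.2 ⟨hfb', mem_erase.2 ⟨hfb, hf⟩⟩), hE7c]
  have hWc : W.card = 2 := by rw [hWdef, card_erase_of_mem ht, card_sdiff_of_subset hπ, hXc, hπ2]
  have hW2 : rk N W = 2 := by
    have h1 := rk_le_card' (M := N) W
    have h2 := rk_insert_le_add_one (N := N) (hXg (hπ hxπ)) (hWX.trans hXg)
    rw [hWc] at h1; omega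
  apply opp_in_coff_of_key h hn hR hnle he hf hef heb heb' hfb hfb' hE7 he1 hX hπ hπ2 hY hYon hef4 hYc hcon hR0 ht htH
    _ hW2
  intro hle
  rw [← hXdef, ← hWdef] at hle
  have hS3 : rk N (π ∪ W) = 3 := by
    have := rk_mono' (M := N) (show insert x W ⊆ π ∪ W from insert_subset (mem_union_left _ hxπ) subset_union_right)
    omega
  have hSon : rk N (insert b (insert b' (π ∪ W))) = 4 := by
    have hs := rk_union_add_rk_le_of_subset_inter' (N := N) (S := π ∪ W) (T := insert b (insert b' (insert x W)))
      (I := insert x W) (by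
        intro w hw; exact mem_inter.2 ⟨insert_subset (mem_union_left _ hxπ) subset_union_right hw,
          mem_insert_of_mem (mem_insert_of_mem hw)⟩)
    have h4 : rk N (insert b (insert b' (π ∪ W))) ≤ rk N (π ∪ W ∪ insert b (insert b' (insert x W))) :=
      rk_mono' (M := N) (by
        intro w hw; simp only [mem_insert, mem_union] at hw ⊢; tauto)
    have := rk_insert_bb'_bounds h (union_subset (hπ.trans hXE) hWE)
    omega
  have hU : rk N (π ∪ W ∪ insert e π) = 4 := by
    rw [union_insert_eq_insert_union' π W e]
    exact rk_insert_e_union_eq_four hn he hf hef heb heb' hfb hfb' hX hπ hY htH hS3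
  have hI' := rk_inter_bb'_le_three_of_two_on h hR (union_subset (hπ.trans hXE) hWE)
    (insert_subset (mem_erase.2 ⟨heb', mem_erase.2 ⟨heb, he⟩⟩) (hπ.trans hXE)) hSon hYon hU
  rw [union_inter_insert_eq (fun h' => heX (hWX h'))] at hI'; exact hI'

end StarSharpD0M

end PercRepro.Cogirth
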